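import Mathlib
import HarnessLib
import Literature.NumberTheory.GaloisRepresentations.ContinuousRep

/-!
# `TwistUnpackaging` (stmt-Langlands-10903) — Negative knowledge VII: the ideator's
`CyclicTwistUnscrewing` is FALSE as typed (`χ = 1` allowed)

The first lemma of the crux idea `prime-order-cyclic-unscrewing`
(`Cruxes/TwistUnpackaging/IdeaSketch-r1-ideator1.lean`, decl `…Sketch.CyclicTwistUnscrewing`)
quantifies over continuous characters `χ : Γ →ₜ* kˣ` with `χ ^ p = 1` — which admits `χ = 1`.
With `χ = 1` the twisted packages `C_j` carry no information beyond `C_0`, and the conclusion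
("`C_0 ≅ ρ₁ ⊕ ρ₂` through characteristic polynomials, `ρ_i` of rank `d`") fails as soon as `C_0`
is irreducible of rank `2d`. Witness (triage r1-3, here formalised): `Γ = S₃` (discrete),
`𝔉 = univ`, `k = ℂ`, `d = 1`, `p = 17 > 16`, `χ = 1`, `C_j =` the standard 2-dimensional
representation for every `j`, `𝔈¹_f ⊔ 𝔈²_f =` its eigenvalues (`{1,1}`, `{1,-1}`, `{ω, ω̄}`);
a rank-1 `ρ_i : S₃ → GL_1(ℂ)` kills the commutator 3-cycle, so `charpoly ρ₁ · charpoly ρ₂` is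
`(X-1)²` there, not `X²+X+1`. REPAIR: require `χ` of exact order `p` (or at least `χ ≠ 1`); the
witness misses the repair. The statement refuted below, `CyclicTwistUnscrewingAsTyped`, is a
VERBATIM copy of the Sketch decl (the Cruxes work-file is not an importable module).
From the standing disprover's `Disproof.lean` (cdisprove gen 3, cycle 3). [folklore]
-/

namespace Summit.Langlands.Langlands.Theorems.TwistUnpackaging.Negative

open Literature.NumberTheory.GaloisRepresentations Equiv Matrix Polynomial

/-- VERBATIM copy of `Summit.Langlands.Langlands.Cruxes.TwistUnpackaging.Sketch.CyclicTwistUnscrewing`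
(ideator 1, gen 2, round 1): finite-order analogue of HLTT Prop. 7.12 for ONE twist `χ` with
`χ ^ p = 1` and its powers. FALSE as typed: `cyclicTwistUnscrewingAsTyped_false`. [folklore] -/
def CyclicTwistUnscrewingAsTyped : Prop :=
  ∀ (Γ : Type) [Group Γ] [TopologicalSpace Γ] [IsTopologicalGroup Γ] (𝔉 : Set Γ), Dense 𝔉 →
  ∀ (k : Type) [Field k] [IsAlgClosed k] [CharZero k] [TopologicalSpace k]
    [IsTopologicalDivisionRing k] [T2Space k] (d p : ℕ), 0 < d → p.Prime → 16 * d ^ 2 < p →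
  ∀ (χ : Γ →ₜ* kˣ), (∀ g, χ g ^ p = 1) →
  ∀ (𝔈₁ 𝔈₂ : Γ → Multiset k),
    (∀ f ∈ 𝔉, Multiset.card (𝔈₁ f) = d ∧ Multiset.card (𝔈₂ f) = d ∧
      (0 : k) ∉ 𝔈₁ f ∧ (0 : k) ∉ 𝔈₂ f) →
  ∀ (J : Set ℕ), 0 ∈ J → (Set.Iio p \ J).Subsingleton →
  ∀ (C : ℕ → FramedRep Γ k (2 * d)),
    (∀ j ∈ J, (C j).toContinuousRep.IsSemisimple) →
    (∀ j ∈ J, ∀ f ∈ 𝔉, (FramedRep.charpoly (C j) f).roots =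
      𝔈₁ f + (𝔈₂ f).map (· * (((χ f) ^ j : kˣ) : k))) →
  ∃ (ρ₁ ρ₂ : FramedRep Γ k d),
    ρ₁.toContinuousRep.IsSemisimple ∧ ρ₂.toContinuousRep.IsSemisimple ∧
    (∀ g, FramedRep.charpoly (C 0) g = FramedRep.charpoly ρ₁ g * FramedRep.charpoly ρ₂ g) ∧
    ∀ f ∈ 𝔉, χ f ≠ 1 →
      (FramedRep.charpoly ρ₁ f).roots = 𝔈₁ f ∧ (FramedRep.charpoly ρ₂ f).roots = 𝔈₂ f

/-! ### The witness: the standard representation of `S₃ = Perm (Fin 3)` -/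

namespace S3

/-- Coordinates of `e₀ ↦ (1,0)`, `e₁ ↦ (0,1)`, `e₂ ↦ (-1,-1)` in `ℤ³/ℤ(1,1,1) ≅ ℤ²`. [folklore] -/
def vec (k : Fin 3) (i : Fin 2) : ℤ :=
  if (k : ℕ) = 2 then -1 else if (k : ℕ) = (i : ℕ) then 1 else 0

/-- The standard representation of `S₃` over `ℤ` in the basis `(e₀, e₁)` of `ℤ³/ℤ(1,1,1)`.
[folklore] -/
def stdZ (σ : Perm (Fin 3)) : Matrix (Fin 2) (Fin 2) ℤ :=
  Matrix.of fun i j => vec (σ (Fin.castSucc j)) i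

/-- `stdZ 1 = 1`. [folklore] -/
theorem stdZ_one : stdZ 1 = 1 := by decide

/-- `stdZ` is multiplicative (checked on all 36 pairs). [folklore] -/
theorem stdZ_mul : ∀ σ τ : Perm (Fin 3), stdZ (σ * τ) = stdZ σ * stdZ τ := by decide

/-- `det stdZ σ = sign σ`. [folklore] -/
theorem stdZ_det : ∀ σ : Perm (Fin 3), (stdZ σ).det = Perm.sign σ := by decide

/-- `tr stdZ σ = #Fix(σ) - 1`. [folklore] -/
theorem stdZ_trace : ∀ σ : Perm (Fin 3),
    (stdZ σ).trace = (Fintype.card (Function.fixedPoints σ) : ℤ) - 1 := by decide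

/-- Transpositions have one fixed point. [folklore] -/
theorem card_fixedPoints_of_sign : ∀ σ : Perm (Fin 3), Perm.sign σ = -1 →
    Fintype.card (Function.fixedPoints σ) = 1 := by decide

/-- Non-trivial even permutations of `Fin 3` (the 3-cycles) have no fixed point. [folklore] -/
theorem card_fixedPoints_three_cycle : ∀ σ : Perm (Fin 3), σ ≠ 1 → Perm.sign σ = 1 →
    Fintype.card (Function.fixedPoints σ) = 0 := by decide

/-- The standard representation over `ℂ` (matrices). [folklore] -/
noncomputable def M (σ : Perm (Fin 3)) : Matrix (Fin 2) (Fin 2) ℂ := (stdZ σ).map (Int.castRingHom ℂ)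

/-- `M` is multiplicative. [folklore] -/
theorem M_mul (σ τ : Perm (Fin 3)) : M (σ * τ) = M σ * M τ := by
  simp only [M, stdZ_mul, Matrix.map_mul]

/-- `M 1 = 1`. [folklore] -/
theorem M_one : M 1 = 1 := by
  simp [M, stdZ_one]

/-- `det M σ = sign σ`. [folklore] -/
theorem M_det (σ : Perm (Fin 3)) : (M σ).det = ((Perm.sign σ : ℤ) : ℂ) := by
  rw [M, ← RingHom.mapMatrix_apply, ← RingHom.map_det, stdZ_det σ, eq_intCast]

/-- `tr M σ = #Fix(σ) - 1`. [folklore] -/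
theorem M_trace (σ : Perm (Fin 3)) :
    (M σ).trace = (Fintype.card (Function.fixedPoints σ) : ℂ) - 1 := by
  have h := stdZ_trace σ
  have : (M σ).trace = (((stdZ σ).trace : ℤ) : ℂ) := by
    simp [M, Matrix.trace_fin_two, Matrix.map_apply]
  rw [this, h]
  push_cast
  ring

/-- The standard representation as a monoid hom into `GL₂(ℂ)`. [folklore] -/
noncomputable def stdGL : Perm (Fin 3) →* GL (Fin 2) ℂ where
  toFun σ := ⟨M σ, M σ⁻¹, by rw [← M_mul, mul_inv_cancel, M_one], by rw [← M_mul, inv_mul_cancel, M_one]⟩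
  map_one' := Units.ext M_one
  map_mul' σ τ := Units.ext (M_mul σ τ)

/-- The discrete topology on `S₃` (a LOCAL instance in this file only). [folklore] -/
@[reducible] def topS3 : TopologicalSpace (Perm (Fin 3)) := ⊥

attribute [local instance] topS3

/-- `S₃` is discrete (local instance). [folklore] -/
theorem discreteS3 : DiscreteTopology (Perm (Fin 3)) := ⟨rfl⟩

attribute [local instance] discreteS3

/-- `S₃` is a topological group for the discrete topology (local instance). [folklore] -/
theorem topGroupS3 : IsTopologicalGroup (Perm (Fin 3)) where
  continuous_mul := continuous_of_discreteTopology
  continuous_inv := continuous_of_discreteTopology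

attribute [local instance] topGroupS3

/-- The standard representation as a framed (continuous) representation. [folklore] -/
noncomputable def stdRep : FramedRep (Perm (Fin 3)) ℂ 2 :=
  { stdGL with continuous_toFun := continuous_of_discreteTopology }

/-- Unfolding `stdRep`. [folklore] -/
theorem stdRep_apply (σ : Perm (Fin 3)) : ((stdRep σ : GL (Fin 2) ℂ) : Matrix (Fin 2) (Fin 2) ℂ) = M σ :=
  rfl

/-- The characteristic polynomial of the standard representation: `X² - (#Fix(σ)-1)X + sign σ`.
[folklore] -/
theorem charpoly_stdRep (σ : Perm (Fin 3)) : FramedRep.charpoly stdRep σ =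
    X ^ 2 - Polynomial.C ((Fintype.card (Function.fixedPoints σ) : ℂ) - 1) * X +
      Polynomial.C (((Perm.sign σ : ℤ) : ℂ)) := by
  rw [FramedRep.charpoly, stdRep_apply, Matrix.charpoly_fin_two, M_trace, M_det]

/-- A primitive cube root of unity and its conjugate, in coordinates. [folklore] -/
noncomputable def ω : ℂ := ⟨-1 / 2, Real.sqrt 3 / 2⟩
/-- The conjugate cube root of unity. [folklore] -/
noncomputable def ω' : ℂ := ⟨-1 / 2, -(Real.sqrt 3 / 2)⟩

/-- `ω + ω̄ = -1`. [folklore] -/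
theorem ω_add_ω' : ω + ω' = -1 := by
  apply Complex.ext <;> simp [ω, ω']

/-- `ω ω̄ = 1`. [folklore] -/
theorem ω_mul_ω' : ω * ω' = 1 := by
  have h3 : Real.sqrt 3 * Real.sqrt 3 = 3 := Real.mul_self_sqrt (by norm_num)
  apply Complex.ext
  · simp [ω, ω', Complex.mul_re]; nlinarith [h3]
  · simp [ω, ω', Complex.mul_im]; ring

/-- `ω ≠ 0`. [folklore] -/
theorem ω_ne_zero : ω ≠ 0 := by
  intro h; have := congrArg Complex.re h; simp [ω] at this

/-- `ω̄ ≠ 0`. [folklore] -/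
theorem ω'_ne_zero : ω' ≠ 0 := by
  intro h; have := congrArg Complex.re h; simp [ω'] at this

/-- Eigenvalue data: first eigenvalue. [folklore] -/
noncomputable def e₁ (σ : Perm (Fin 3)) : ℂ := if σ = 1 then 1 else if Perm.sign σ = -1 then 1 else ω
/-- Eigenvalue data: second eigenvalue. [folklore] -/
noncomputable def e₂ (σ : Perm (Fin 3)) : ℂ := if σ = 1 then 1 else if Perm.sign σ = -1 then -1 else ω'

/-- First eigenvalues are non-zero. [folklore] -/
theorem e₁_ne_zero (σ : Perm (Fin 3)) : e₁ σ ≠ 0 := by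
  unfold e₁; split_ifs <;> first | exact one_ne_zero | exact ω_ne_zero

/-- Second eigenvalues are non-zero. [folklore] -/
theorem e₂_ne_zero (σ : Perm (Fin 3)) : e₂ σ ≠ 0 := by
  unfold e₂; split_ifs
  · exact one_ne_zero
  · norm_num
  · exact ω'_ne_zero

/-- Factorisation of a monic quadratic from the sum and product of two numbers. [folklore] -/
theorem quad_factor (t δ a b : ℂ) (hs : a + b = t) (hp : a * b = δ) :
    (X ^ 2 - Polynomial.C t * X + Polynomial.C δ : ℂ[X]) =
      (X - Polynomial.C a) * (X - Polynomial.C b) := by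
  have e1 : Polynomial.C a + Polynomial.C b = Polynomial.C t := by rw [← Polynomial.C_add, hs]
  have e2 : Polynomial.C a * Polynomial.C b = Polynomial.C δ := by rw [← Polynomial.C_mul, hp]
  linear_combination (X : ℂ[X]) * e1 - e2

/-- Roots of a monic quadratic from sum and product. [folklore] -/
theorem roots_quad (t δ a b : ℂ) (hs : a + b = t) (hp : a * b = δ) :
    (X ^ 2 - Polynomial.C t * X + Polynomial.C δ : ℂ[X]).roots = {a, b} := by
  rw [quad_factor t δ a b hs hp, Polynomial.roots_mul (mul_ne_zero (Polynomial.X_sub_C_ne_zero a)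
    (Polynomial.X_sub_C_ne_zero b)), Polynomial.roots_X_sub_C, Polynomial.roots_X_sub_C]
  rfl

/-- The eigenvalues of the standard representation. [folklore] -/
theorem roots_charpoly_stdRep (σ : Perm (Fin 3)) :
    (FramedRep.charpoly stdRep σ).roots = {e₁ σ, e₂ σ} := by
  rw [charpoly_stdRep]
  by_cases h1 : σ = 1
  · subst h1
    apply roots_quad
    · have : Fintype.card (Function.fixedPoints ((1 : Perm (Fin 3)) : Fin 3 → Fin 3)) = 3 := by
        decide
      simp only [e₁, e₂, if_true, this]
      norm_num
    · simp [e₁, e₂]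
  · by_cases hs : Perm.sign σ = -1
    · apply roots_quad
      · simp [e₁, e₂, h1, hs, card_fixedPoints_of_sign σ hs]
      · simp [e₁, e₂, h1, hs]
    · have hs1 : Perm.sign σ = 1 := (Int.units_eq_one_or (Perm.sign σ)).resolve_right hs
      apply roots_quad
      · simp [e₁, e₂, h1, hs1, card_fixedPoints_three_cycle σ h1 hs1, ω_add_ω']
      · simp [e₁, e₂, h1, hs1, ω_mul_ω']

/-- The commutator 3-cycle `c = [(0 1), (1 2)]`. [folklore] -/
def c : Perm (Fin 3) := swap 0 1 * swap 1 2 * (swap 0 1)⁻¹ * (swap 1 2)⁻¹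

/-- `c ≠ 1`. [folklore] -/
theorem c_ne_one : c ≠ 1 := by decide
/-- `c` is even. [folklore] -/
theorem sign_c : Perm.sign c = 1 := by decide

/-- A rank-1 representation kills the commutator `c`: `det ρ c = 1`. [folklore] -/
theorem det_rank_one_c (ρ : FramedRep (Perm (Fin 3)) ℂ 1) :
    Matrix.GeneralLinearGroup.det (ρ c) = 1 := by
  let φ : Perm (Fin 3) →* ℂˣ := (Matrix.GeneralLinearGroup.det).comp ρ.toMonoidHom
  have hφ : ∀ σ, Matrix.GeneralLinearGroup.det (ρ σ) = φ σ := fun σ => rfl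
  rw [hφ, c, map_mul, map_mul, map_mul, map_inv, map_inv, mul_comm (φ (swap 0 1)) (φ (swap 1 2))]
  group

/-- The characteristic polynomial of a rank-1 representation at `c` is `X - 1`. [folklore] -/
theorem charpoly_rank_one_c (ρ : FramedRep (Perm (Fin 3)) ℂ 1) :
    FramedRep.charpoly ρ c = X - Polynomial.C 1 := by
  have hdet := det_rank_one_c ρ
  have hval : ((ρ c : GL (Fin 1) ℂ) : Matrix (Fin 1) (Fin 1) ℂ) 0 0 = 1 := by
    have : ((Matrix.GeneralLinearGroup.det (ρ c) : ℂˣ) : ℂ) = 1 := by rw [hdet]; rfl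
    rwa [Matrix.GeneralLinearGroup.val_det_apply, Matrix.det_fin_one] at this
  rw [FramedRep.charpoly, Matrix.charpoly, Matrix.det_fin_one, Matrix.charmatrix_apply_eq, hval]

end S3

attribute [local instance] S3.topS3 S3.discreteS3 S3.topGroupS3

open S3 in
/-- **`CyclicTwistUnscrewing` is FALSE as typed.** Witness: `Γ = S₃`, `𝔉 = univ`, `k = ℂ`,
`d = 1`, `p = 17`, `χ = 1`, `C_j = std` for all `j`, `J = univ`. Repair: `χ` of exact order `p`
(then `χ(c) ≠ 1` is impossible for `S₃` and `p = 17`, and the witness disappears). [folklore] -/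
theorem cyclicTwistUnscrewingAsTyped_false : ¬ CyclicTwistUnscrewingAsTyped := by
  intro h
  haveI : NeZero ((Nat.card (Perm (Fin 3)) : ℂ)) :=
    ⟨by rw [Nat.card_eq_fintype_card, Fintype.card_perm]; norm_num⟩
  have hss : (stdRep).toContinuousRep.IsSemisimple := by
    change stdRep.toContinuousRep.toRepresentation.IsSemisimpleRepresentation
    infer_instance
  obtain ⟨ρ₁, ρ₂, -, -, hC0, -⟩ := h (Perm (Fin 3)) Set.univ dense_univ ℂ 1 17 one_pos
    (by norm_num) (by norm_num) 1 (fun g => by rw [show (1 : Perm (Fin 3) →ₜ* ℂˣ) g = 1 from rfl, one_pow])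
    (fun σ => {e₁ σ}) (fun σ => {e₂ σ})
    (fun σ _ => ⟨rfl, rfl, by simpa using (e₁_ne_zero σ).symm, by simpa using (e₂_ne_zero σ).symm⟩)
    Set.univ (Set.mem_univ 0) (by simp) (fun _ => stdRep) (fun _ _ => hss)
    (fun j _ σ _ => by
      rw [roots_charpoly_stdRep, show (1 : Perm (Fin 3) →ₜ* ℂˣ) σ = 1 from rfl, one_pow]
      simp)
  have key := congrArg (Polynomial.eval 1) (hC0 c)
  rw [charpoly_stdRep, charpoly_rank_one_c, charpoly_rank_one_c,
    card_fixedPoints_three_cycle c c_ne_one sign_c, sign_c] at key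
  norm_num at key

end Summit.Langlands.Langlands.Theorems.TwistUnpackaging.Negative
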